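import Summits.Ventures.LatticeQCDFlow.Scaling.DominatedStarAutocorrelationCeiling
import Summits.Ventures.LatticeQCDFlow.Scaling.ColdReplicaAutocorrelation

/-!
HONEST FRAMING: exact (Metropolis-corrected) sampling algorithms for lattice gauge theory; figures
of merit are autocorrelation/cost numbers at stated couplings and volumes; no continuum-physics
claim.

# DominatedStarAutocorrelationLaw — THE SECTOR AUTOCORRELATION TIME OF A COLD REPLICA OF THE MAP-ASSISTED
# HOT-REFRESHED HUB FROM BOTH SIDES: UNDER ONE-SIDED DOMINATION `p` AND `4t ≤ p(1−t)w_0`, FOR A SECTOR `A` PRESERVED BY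
# THE MAPS AND A COLD REPLICA `k+1` WHOSE OWN UPDATES DO NOT CROSS IT,
# `2m·μ_{k+1}(A)μ_{k+1}(Aᶜ)/(t·c_k) − ½ ≤ τ_int(𝟙_A(x_{k+1})) ≤ 2m/(tcp) − ½` — BOTH SIDES ORDER `m/(tc)`, I.E. `K/t`
# AT UNIFORM LISTING (lean-2 GEN-26, ours)

Venture-side (OURS).  Cell `lqcd-flow` (pub-lqcd), unit `pub-lqcd-lean-2-g26`, 2026-08-27.  Chapter M, file 21.  The floor
is chapter K's `Scaling/ColdReplicaAutocorrelation.idleReplica_tauInt_ge` (every acceptance is at most one, so a cold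
replica that only tunnels through the hub relaxes its sector indicator no faster than its proposal rate `t·c_k/m`
allows), whose irreducibility hypothesis is now discharged by `Scaling/DominatedStarTimeAverages`; the ceiling is
`Scaling/DominatedStarAutocorrelationCeiling`.  Setting: hub list `e_r = (0, κ_r+1)` of length `m`, `c_k = #{r : κ_r = k}`
(`≥ c ≥ 1`), bijections `φ_r` preserving the sector `A` (`φ_r u ∈ A ↔ u ∈ A`), positive laws, exact hot sampler,
`μ_j`-reversible cold kernels with `w_{k+1}·Q_{k+1}(A,Aᶜ) = 0` for the replica under study, `|S| ≥ 2`.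

## What is proved

* **`dominatedStar_tauInt_two_sided`** — `0 < μ_{k+1}(A)μ_{k+1}(Aᶜ)`, one-sided domination, `4t ≤ p(1−t)w_0`, `0 < t`:
  **`2m·μ_{k+1}(A)μ_{k+1}(Aᶜ)/(t·c_k) − ½ ≤ τ_int(f_A^{(μ_{k+1})}(x_{k+1})) ≤ 1/(tcp/(2m)) − ½`**.
* **`perfectStar_tauInt_two_sided`** — perfect transports, `0 < t < 1`, `w_0 > 0`: the same floor and the ceiling
  `1/(tc(1−t)w_0/(t(m+c) + (1−t)w_0·m)) − ½` of the best hub weight.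
* **`hotOnlyStar_tauInt_two_sided`** — hot-only updates: the idleness hypothesis is automatic.
* **`uniformStar_tauInt_two_sided`** — uniform listing (`c_k = c` for all `k`, `m = cK`): 
  **`2K·μ_{k+1}(A)μ_{k+1}(Aᶜ)/t − ½ ≤ τ_int ≤ 1/(tp/(2K)) − ½`**.

Reading (no numerics implied): for flow-assisted parallel tempering on the hub the integrated autocorrelation time of
the topological-sector indicator of any cold replica that cannot tunnel by itself is pinned, up to the factors
`μ(A)μ(Aᶜ)` and `4/p`, at `K/t` sweeps at uniform listing — the learned transport's quality enters the ceiling through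
`p` only, and no transport can beat the floor.  NOT CLAIMED: replicas whose own updates tunnel (`Q_{k+1}(A,Aᶜ) > 0`);
maps that do not preserve the sector; anything measured.  Literature grade (cell rule): OWN RESULT (composition of the
tree's chapter-K floor and chapter-M ceiling); nothing cited as a fact; no new bib keys.
-/

noncomputable section

open Finset Function
open Literature.Probability.MarkovChains

namespace Summit.Ventures.LatticeQCDFlow.Scaling

variable {S : Type*} [Fintype S] [DecidableEq S] {K m : ℕ} {μ : Fin (K + 1) → S → ℝ} {M : Fin (K + 1) → S → S → ℝ}
  {w : Fin (K + 1) → ℝ} {t p : ℝ}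

section Law
variable (κ : Fin m → Fin K) (φ : Fin m → Equiv.Perm S)

/-- **THE SECTOR AUTOCORRELATION TIME OF COLD REPLICA `k+1` FROM BOTH SIDES** (one-sided domination,
`4t ≤ p(1−t)w_0`, `0 < t ≤ 1`, maps preserving `A`, the replica's own updates not crossing `A`, `c ≤ c_k`, `|S| ≥ 2`):
**`2m·μ_{k+1}(A)μ_{k+1}(Aᶜ)/(t·c_k) − ½ ≤ τ_int(f_A(x_{k+1})) ≤ 1/(tcp/(2m)) − ½`.** [ours] -/
theorem dominatedStar_tauInt_two_sided [Nontrivial S] (hm : 1 ≤ m) (ht0 : 0 < t) (ht1 : t ≤ 1) (hw0 : ∀ k, 0 ≤ w k)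
    (hw1 : ∑ k, w k = 1) (hμ : ∀ k x, 0 < μ k x) (hμ1 : ∀ k, ∑ u, μ k u = 1) (hM : ∀ k, IsRowStochastic (M k))
    (hMrev : ∀ k, DetailedBalance (μ k) (M k)) (hM0 : ∀ u v, M 0 u v = μ 0 v) (hp0 : 0 < p) (hp1 : p ≤ 1)
    (hdom : ∀ r u, p * μ (κ r).succ (φ r u) ≤ μ 0 u) (hreg : 4 * t ≤ p * (1 - t) * w 0)
    {c : ℕ} (hc1 : 1 ≤ c) (hc : ∀ p' : Fin K, c ≤ (univ.filter (fun r : Fin m => κ r = p')).card) (hcm : c ≤ m)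
    {A : Finset S} (hφA : ∀ r u, φ r u ∈ A ↔ u ∈ A) (k : Fin K)
    (hAk : 0 < (∑ u ∈ A, μ k.succ u) * ∑ u ∈ Aᶜ, μ k.succ u)
    (hidle : w k.succ * edgeMeasure (μ k.succ) (M k.succ) A Aᶜ = 0) :
    2 * m * ((∑ u ∈ A, μ k.succ u) * ∑ u ∈ Aᶜ, μ k.succ u)
          / (t * ((univ.filter (fun r : Fin m => κ r = k)).card : ℝ)) - 1 / 2
        ≤ asympVar (fun x : Fin (K + 1) → S => bottleneckTestFun (μ k.succ) A (x k.succ)) (tensorFun μ)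
            (fun y z : Fin (K + 1) → S =>
              t * ptGraphSwap μ (fun r : Fin m => (((0 : Fin (K + 1)), (κ r).succ) : Fin (K + 1) × Fin (K + 1))) φ y z
                + (1 - t) * prodKernel w M y z)
          / (2 * lawVariance (tensorFun μ) (fun x : Fin (K + 1) → S => bottleneckTestFun (μ k.succ) A (x k.succ))) ∧
      asympVar (fun x : Fin (K + 1) → S => bottleneckTestFun (μ k.succ) A (x k.succ)) (tensorFun μ)
            (fun y z : Fin (K + 1) → S =>
              t * ptGraphSwap μ (fun r : Fin m => (((0 : Fin (K + 1)), (κ r).succ) : Fin (K + 1) × Fin (K + 1))) φ y z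
                + (1 - t) * prodKernel w M y z)
          / (2 * lawVariance (tensorFun μ) (fun x : Fin (K + 1) → S => bottleneckTestFun (μ k.succ) A (x k.succ)))
        ≤ 1 / (t * c * p / (2 * m)) - 1 / 2 := by
  refine ⟨?_, dominatedStar_tauInt_le κ φ hm ht0 ht1 hw0 hw1 hμ hμ1 hM hMrev hM0 hp0 hp1 hdom hreg hc1 hc hcm _⟩
  have hirr := dominatedStar_isIrreducible κ φ hm ht0 ht1 hw0 hw1 hμ hμ1 hM hMrev hM0 hp0 hp1 hdom hreg hc1 hc hcm
  have hdeg : 1 ≤ (univ.filter fun r : Fin m =>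
      ((fun r : Fin m => (((0 : Fin (K + 1)), (κ r).succ) : Fin (K + 1) × Fin (K + 1))) r).1 = k.succ ∨
      ((fun r : Fin m => (((0 : Fin (K + 1)), (κ r).succ) : Fin (K + 1) × Fin (K + 1))) r).2 = k.succ).card := by
    rw [hubList_degree_succ κ k]; exact hc1.trans (hc k)
  have h := idleReplica_tauInt_ge (e := fun r : Fin m => (((0 : Fin (K + 1)), (κ r).succ) : Fin (K + 1) × Fin (K + 1)))
    (φ := φ) hm (hubList_fst_ne_snd κ) hμ hμ1 hM hMrev hw0 hw1 ht0 ht1 hφA k.succ hAk hidle hdeg hirr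
  rw [hubList_degree_succ κ k] at h
  exact h

/-- **PERFECT TRANSPORTS, BOTH SIDES:** the same floor and the best-weight ceiling
`1/(tc(1−t)w_0/(t(m+c) + (1−t)w_0·m)) − ½` (`0 < t < 1`, `w_0 > 0`). [ours] -/
theorem perfectStar_tauInt_two_sided [Nontrivial S] (hm : 1 ≤ m) (ht0 : 0 < t) (ht1 : t < 1) (hw0 : ∀ k, 0 ≤ w k)
    (hw00 : 0 < w 0) (hw1 : ∑ k, w k = 1) (hμ : ∀ k x, 0 < μ k x) (hμ1 : ∀ k, ∑ u, μ k u = 1)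
    (hM : ∀ k, IsRowStochastic (M k)) (hMrev : ∀ k, DetailedBalance (μ k) (M k)) (hM0 : ∀ u v, M 0 u v = μ 0 v)
    (hperf : ∀ r u, μ (κ r).succ (φ r u) = μ 0 u) {c : ℕ} (hc1 : 1 ≤ c)
    (hc : ∀ p' : Fin K, c ≤ (univ.filter (fun r : Fin m => κ r = p')).card) (hcm : c ≤ m)
    {A : Finset S} (hφA : ∀ r u, φ r u ∈ A ↔ u ∈ A) (k : Fin K)
    (hAk : 0 < (∑ u ∈ A, μ k.succ u) * ∑ u ∈ Aᶜ, μ k.succ u)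
    (hidle : w k.succ * edgeMeasure (μ k.succ) (M k.succ) A Aᶜ = 0) :
    2 * m * ((∑ u ∈ A, μ k.succ u) * ∑ u ∈ Aᶜ, μ k.succ u)
          / (t * ((univ.filter (fun r : Fin m => κ r = k)).card : ℝ)) - 1 / 2
        ≤ asympVar (fun x : Fin (K + 1) → S => bottleneckTestFun (μ k.succ) A (x k.succ)) (tensorFun μ)
            (fun y z : Fin (K + 1) → S =>
              t * ptGraphSwap μ (fun r : Fin m => (((0 : Fin (K + 1)), (κ r).succ) : Fin (K + 1) × Fin (K + 1))) φ y z
                + (1 - t) * prodKernel w M y z)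
          / (2 * lawVariance (tensorFun μ) (fun x : Fin (K + 1) → S => bottleneckTestFun (μ k.succ) A (x k.succ))) ∧
      asympVar (fun x : Fin (K + 1) → S => bottleneckTestFun (μ k.succ) A (x k.succ)) (tensorFun μ)
            (fun y z : Fin (K + 1) → S =>
              t * ptGraphSwap μ (fun r : Fin m => (((0 : Fin (K + 1)), (κ r).succ) : Fin (K + 1) × Fin (K + 1))) φ y z
                + (1 - t) * prodKernel w M y z)
          / (2 * lawVariance (tensorFun μ) (fun x : Fin (K + 1) → S => bottleneckTestFun (μ k.succ) A (x k.succ)))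
        ≤ 1 / (t * c * ((1 - t) * w 0) / (t * ((m : ℝ) + c) + (1 - t) * w 0 * m)) - 1 / 2 := by
  refine ⟨?_, bestPerfectStar_tauInt_le κ φ hm ht0 ht1 hw0 hw00 hw1 hμ hμ1 hM hMrev hM0 hperf hc1 hc hcm _⟩
  -- irreducibility: perfect maps dominate one-sidedly with `p = 1`; use the separation minorisation directly
  have hstat : ∀ j : Fin (K + 1), j ≠ 0 → ∀ v, ∑ u, μ j u * M j u v = μ j v :=
    fun j _ v => (hMrev j).isStationary (hM j).2 v
  have hKp : 0 < 2 * ((K : ℝ) + 1) := by positivity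
  have hmpos : (0 : ℝ) < m := Nat.cast_pos.mpr (by omega)
  have hcpos : (0 : ℝ) < c := Nat.cast_pos.mpr (by omega)
  have hρ1 : 1 - t * (1 - t) * w 0 * c / (2 * m) < 1 := by
    have : 0 < t * (1 - t) * w 0 * c / (2 * m) := by
      have h1t : 0 < 1 - t := by linarith
      positivity
    linarith
  obtain ⟨n, hn⟩ := exists_pow_lt_of_lt_one (div_pos one_pos hKp) hρ1
  have hlt : 2 * ((K : ℝ) + 1) * (1 - t * (1 - t) * w 0 * c / (2 * m)) ^ n < 1 := by
    have h1 := mul_lt_mul_of_pos_left hn hKp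
    rwa [mul_div_cancel₀ _ hKp.ne'] at h1
  have hirr : Literature.Probability.MarkovChains.IsIrreducible (fun y z : Fin (K + 1) → S =>
      t * ptGraphSwap μ (fun r : Fin m => (((0 : Fin (K + 1)), (κ r).succ) : Fin (K + 1) × Fin (K + 1))) φ y z
        + (1 - t) * prodKernel w M y z) := by
    refine isIrreducible_of_kernelAt_pos (n := n) fun x z => ?_
    have hge := perfectStar_kernelAt_ge κ φ hm ht0 ht1 hw0 hw00 hw1 hμ hμ1 hM hM0 hstat hperf hc1 hc hcm n x z
    exact lt_of_lt_of_le (mul_pos (by linarith) (tensorFun_pos hμ z)) hge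
  have hdeg : 1 ≤ (univ.filter fun r : Fin m =>
      ((fun r : Fin m => (((0 : Fin (K + 1)), (κ r).succ) : Fin (K + 1) × Fin (K + 1))) r).1 = k.succ ∨
      ((fun r : Fin m => (((0 : Fin (K + 1)), (κ r).succ) : Fin (K + 1) × Fin (K + 1))) r).2 = k.succ).card := by
    rw [hubList_degree_succ κ k]; exact hc1.trans (hc k)
  have h := idleReplica_tauInt_ge (e := fun r : Fin m => (((0 : Fin (K + 1)), (κ r).succ) : Fin (K + 1) × Fin (K + 1)))
    (φ := φ) hm (hubList_fst_ne_snd κ) hμ hμ1 hM hMrev hw0 hw1 ht0 ht1.le hφA k.succ hAk hidle hdeg hirr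
  rw [hubList_degree_succ κ k] at h
  exact h

/-- **UNIFORM LISTING (`c_k = c` for every cold level, `m = cK`), BOTH SIDES:**
**`2K·μ_{k+1}(A)μ_{k+1}(Aᶜ)/t − ½ ≤ τ_int(f_A(x_{k+1})) ≤ 1/(tp/(2K)) − ½`** under one-sided domination and
`4t ≤ p(1−t)w_0`. [ours] -/
theorem uniformStar_tauInt_two_sided [Nontrivial S] (ht0 : 0 < t) (ht1 : t ≤ 1) (hw0 : ∀ k, 0 ≤ w k)
    (hw1 : ∑ k, w k = 1) (hμ : ∀ k x, 0 < μ k x) (hμ1 : ∀ k, ∑ u, μ k u = 1) (hM : ∀ k, IsRowStochastic (M k))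
    (hMrev : ∀ k, DetailedBalance (μ k) (M k)) (hM0 : ∀ u v, M 0 u v = μ 0 v) (hp0 : 0 < p) (hp1 : p ≤ 1)
    (hdom : ∀ r u, p * μ (κ r).succ (φ r u) ≤ μ 0 u) (hreg : 4 * t ≤ p * (1 - t) * w 0)
    {c : ℕ} (hc1 : 1 ≤ c) (hK : 1 ≤ K) (hc : ∀ p' : Fin K, (univ.filter (fun r : Fin m => κ r = p')).card = c)
    (hmc : m = c * K) {A : Finset S} (hφA : ∀ r u, φ r u ∈ A ↔ u ∈ A) (k : Fin K)
    (hAk : 0 < (∑ u ∈ A, μ k.succ u) * ∑ u ∈ Aᶜ, μ k.succ u)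
    (hidle : w k.succ * edgeMeasure (μ k.succ) (M k.succ) A Aᶜ = 0) :
    2 * K * ((∑ u ∈ A, μ k.succ u) * ∑ u ∈ Aᶜ, μ k.succ u) / t - 1 / 2
        ≤ asympVar (fun x : Fin (K + 1) → S => bottleneckTestFun (μ k.succ) A (x k.succ)) (tensorFun μ)
            (fun y z : Fin (K + 1) → S =>
              t * ptGraphSwap μ (fun r : Fin m => (((0 : Fin (K + 1)), (κ r).succ) : Fin (K + 1) × Fin (K + 1))) φ y z
                + (1 - t) * prodKernel w M y z)
          / (2 * lawVariance (tensorFun μ) (fun x : Fin (K + 1) → S => bottleneckTestFun (μ k.succ) A (x k.succ))) ∧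
      asympVar (fun x : Fin (K + 1) → S => bottleneckTestFun (μ k.succ) A (x k.succ)) (tensorFun μ)
            (fun y z : Fin (K + 1) → S =>
              t * ptGraphSwap μ (fun r : Fin m => (((0 : Fin (K + 1)), (κ r).succ) : Fin (K + 1) × Fin (K + 1))) φ y z
                + (1 - t) * prodKernel w M y z)
          / (2 * lawVariance (tensorFun μ) (fun x : Fin (K + 1) → S => bottleneckTestFun (μ k.succ) A (x k.succ)))
        ≤ 1 / (t * p / (2 * K)) - 1 / 2 := by
  have hm : 1 ≤ m := by rw [hmc]; exact Nat.one_le_iff_ne_zero.mpr (Nat.mul_ne_zero (by omega) (by omega))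
  have hcm : c ≤ m := by rw [hmc]; exact Nat.le_mul_of_pos_right c (by omega)
  have hc' : ∀ p' : Fin K, c ≤ (univ.filter (fun r : Fin m => κ r = p')).card := fun p' => (hc p').ge
  obtain ⟨hlo, hhi⟩ := dominatedStar_tauInt_two_sided κ φ hm ht0 ht1 hw0 hw1 hμ hμ1 hM hMrev hM0 hp0 hp1 hdom hreg hc1
    hc' hcm hφA k hAk hidle
  have hcpos : (0 : ℝ) < c := Nat.cast_pos.mpr (by omega)
  have hKpos : (0 : ℝ) < K := Nat.cast_pos.mpr (by omega)
  have hmR : (m : ℝ) = c * K := by rw [hmc, Nat.cast_mul]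
  constructor
  · rw [hc k, hmR] at hlo
    have e : 2 * ((c : ℝ) * K) * ((∑ u ∈ A, μ k.succ u) * ∑ u ∈ Aᶜ, μ k.succ u) / (t * c)
        = 2 * K * ((∑ u ∈ A, μ k.succ u) * ∑ u ∈ Aᶜ, μ k.succ u) / t := by
      field_simp
    rw [e] at hlo
    exact hlo
  · have e : t * c * p / (2 * (m : ℝ)) = t * p / (2 * K) := by
      rw [hmR]
      field_simp
    rw [e] at hhi
    exact hhi

/-- **HOT-ONLY UPDATES, BOTH SIDES:** with `w = 𝟙_{k=0}` no cold replica tunnels by itself (the idleness hypothesis is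
automatic), so for every sector `A` preserved by the maps and every cold level `k+1`:
**`2m·μ_{k+1}(A)μ_{k+1}(Aᶜ)/(t·c_k) − ½ ≤ τ_int(f_A(x_{k+1})) ≤ 1/(tcp/(2m)) − ½`** under one-sided domination and
`4t ≤ p(1−t)`. [ours] -/
theorem hotOnlyStar_tauInt_two_sided [Nontrivial S] (hm : 1 ≤ m) (ht0 : 0 < t) (ht1 : t ≤ 1)
    (hμ : ∀ k x, 0 < μ k x) (hμ1 : ∀ k, ∑ u, μ k u = 1) (hM : ∀ k, IsRowStochastic (M k))
    (hMrev : ∀ k, DetailedBalance (μ k) (M k)) (hM0 : ∀ u v, M 0 u v = μ 0 v) (hp0 : 0 < p) (hp1 : p ≤ 1)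
    (hdom : ∀ r u, p * μ (κ r).succ (φ r u) ≤ μ 0 u) (hreg : 4 * t ≤ p * (1 - t))
    {c : ℕ} (hc1 : 1 ≤ c) (hc : ∀ p' : Fin K, c ≤ (univ.filter (fun r : Fin m => κ r = p')).card) (hcm : c ≤ m)
    {A : Finset S} (hφA : ∀ r u, φ r u ∈ A ↔ u ∈ A) (k : Fin K)
    (hAk : 0 < (∑ u ∈ A, μ k.succ u) * ∑ u ∈ Aᶜ, μ k.succ u) :
    2 * m * ((∑ u ∈ A, μ k.succ u) * ∑ u ∈ Aᶜ, μ k.succ u)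
          / (t * ((univ.filter (fun r : Fin m => κ r = k)).card : ℝ)) - 1 / 2
        ≤ asympVar (fun x : Fin (K + 1) → S => bottleneckTestFun (μ k.succ) A (x k.succ)) (tensorFun μ)
            (fun y z : Fin (K + 1) → S =>
              t * ptGraphSwap μ (fun r : Fin m => (((0 : Fin (K + 1)), (κ r).succ) : Fin (K + 1) × Fin (K + 1))) φ y z
                + (1 - t) * prodKernel (fun j : Fin (K + 1) => if j = 0 then (1 : ℝ) else 0) M y z)
          / (2 * lawVariance (tensorFun μ) (fun x : Fin (K + 1) → S => bottleneckTestFun (μ k.succ) A (x k.succ))) ∧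
      asympVar (fun x : Fin (K + 1) → S => bottleneckTestFun (μ k.succ) A (x k.succ)) (tensorFun μ)
            (fun y z : Fin (K + 1) → S =>
              t * ptGraphSwap μ (fun r : Fin m => (((0 : Fin (K + 1)), (κ r).succ) : Fin (K + 1) × Fin (K + 1))) φ y z
                + (1 - t) * prodKernel (fun j : Fin (K + 1) => if j = 0 then (1 : ℝ) else 0) M y z)
          / (2 * lawVariance (tensorFun μ) (fun x : Fin (K + 1) → S => bottleneckTestFun (μ k.succ) A (x k.succ)))
        ≤ 1 / (t * c * p / (2 * m)) - 1 / 2 := by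
  have hw0 : ∀ j : Fin (K + 1), 0 ≤ (if j = 0 then (1 : ℝ) else 0) := fun j => by split_ifs <;> norm_num
  have hw1 : ∑ j : Fin (K + 1), (if j = 0 then (1 : ℝ) else 0) = 1 := by
    rw [Finset.sum_ite_eq' univ (0 : Fin (K + 1)), if_pos (mem_univ _)]
  have hreg' : 4 * t ≤ p * (1 - t) * (if (0 : Fin (K + 1)) = 0 then (1 : ℝ) else 0) := by
    rw [if_pos rfl, mul_one]; exact hreg
  have hidle : (if k.succ = 0 then (1 : ℝ) else 0) * edgeMeasure (μ k.succ) (M k.succ) A Aᶜ = 0 := by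
    rw [if_neg (Fin.succ_ne_zero k), zero_mul]
  exact dominatedStar_tauInt_two_sided κ φ hm ht0 ht1 hw0 hw1 hμ hμ1 hM hMrev hM0 hp0 hp1 hdom hreg' hc1 hc hcm hφA k hAk
    hidle

end Law

end Summit.Ventures.LatticeQCDFlow.Scaling

end
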